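import Mathlib
import Literature.Combinatorics.Optimization.SheraliAdamsSdpPairwiseIndependence
import Literature.Combinatorics.Optimization.RandomPairMultigraphCuts
import Literature.Computability.MetaComplexity.ScopeExpansionProofs
import HarnessLib

/-!
# The Sherali–Adams SDP (`SA₊`) gap from pairwise independence
# (Benabbas–Georgiou–Magen–Tulsiani 2012, Theorem 4.3 in full; Georgiou Thm 8.5.3), proved

[topic Combinatorics/Optimization]

> **[BGMT12] Theorem 4.3.** "Let `P : [q]^k → {0,1}` be a promising predicate. Then for every
> constant `ζ > 0`, there exist `c = c(q, k, ζ)`, such that for large enough `n`, the integrality gap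
> of MAX k-CSP_q(`P`) for the program obtained by `cn` levels of the Sherali–Adams SDP hierarchy is at
> least `q^k/|P⁻¹(1)| − ζ`."  (§4, first paragraph: "our integrality gap instance will be a random
> instance `Φ` of the MAX k-CSP_q(`P`) problem, conditioned on no two constraints sharing more than one
> variable."  Lemma 4.1: such instances have, with positive probability, `OPT ≤ (|P⁻¹(1)|/q^k)(1+ε)m`
> and `(ηn, k − 2 − δ)` boundary expansion.)

`SheraliAdamsSdpPairwiseIndependence.lean` proved the SDP half for ONE expanding instance satisfying
hypothesis (3) "no two constraints share more than one variable"
(`PairwiseIndependence.exists_saPlusSolution_lits`).  This file supplies the instances and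
assembles the theorem (`q = 2`):

* `sharedPairs ω` — the pairs of positions `s < t` of a clause tuple whose scopes share `≥ 2`
  variables; `card_filter_mem_sharedPairs_le` — for fixed `s < t` at most
  `C(n, 2k−2)·(C(2k−2, k) 2^k)²·|X|^{m−2}` tuples have `(s,t)` shared (both scopes lie in a common
  set of `2k − 2` variables; the tree's `card_filter_forall_clauseScope_subset_le`);
  `sum_card_sharedPairs_le` — the first moment `Σ_ω |sharedPairs ω| ≤ ∆² K₀ |X|^m` with
  `K₀ = 64^k (k!)²` (from `n² C(n,2k−2) C(2k−2,k)² ≤ K₀ C(n,k)²`, `n ≥ 2k`); by Markov at most a third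
  of the tuples have `≥ 3∆²K₀` shared pairs (`card_manyShared_le`).
* **Alteration instead of conditioning** (RECORDED DEVIATION, same role as the "small alterations" of
  [AroraBollobasLovaszTourlakis2006] Lemma 2.8 used for the CMM graphs): delete every position `t`
  having an earlier `s` with `|scope_s ∩ scope_t| ≥ 2` (`keep`, `subTuple`); the remaining tuple has
  pairwise scope intersections `≤ 1` (`subTuple_pairwise`), inherits cover expansion
  (`isCoverExpander_subTuple`), loses at most `|sharedPairs|` positions (`card_compl_keep_le`), and
  every assignment satisfies at most as many of its constraints as before (`card_sat_subTuple_le`).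
* `exists_strong_predTupleK3` — Lemma 8.5.1 (1),(2),(3) / [BGMT12] Lemma 4.1 with hypothesis (3):
  for `k ≥ 3`, `0 < ε ≤ 1`, some tuple of `m` clauses (`∆n − 3∆²K₀ ≤ m ≤ ∆n`) is a
  `(⌊κn⌋, k − 9/8)`-cover expander, has pairwise scope intersections `≤ 1`, and no assignment
  satisfies more than `(|P⁻¹(1)|/2^k + ε)m` of its `P`-constraints (three-event union bound on the
  tuples of `∆n` clauses, then the alteration).
* **`BenabbasGeorgiouMagenTulsiani2012_saPlusValue_eq_one`** — Thm 4.3 in full (value form): for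
  `k ≥ 3`, `P` promising, `ε > 0` there are `c_ε > 0`, `n₀` with, for all `n ≥ n₀`, an instance `ℑ`
  of Max-`k`-CSP(`P`) on `n` variables with `opt(ℑ) ≤ |P⁻¹(1)|/2^k + ε` and a level-`⌊c_ε n⌋`
  Sherali–Adams SDP solution (`SAPlusSolution`: consistent local distributions + the vectors (3.32))
  whose Sherali–Adams functional gives `ℑ` value exactly `1`; and
  `BenabbasGeorgiouMagenTulsiani2012_saPlusGap` — the integrality-gap form: value `1` versus
  `opt ≤ |P⁻¹(1)|/2^k + ε` (ratio `≥ 2^k/|P⁻¹(1)| − ζ`).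

Everything is proved; no named facts; no `sorry`.

## References

* [BenabbasGeorgiouMagenTulsiani2012] S. Benabbas, K. Georgiou, A. Magen, M. Tulsiani, *SDP gaps from
  pairwise independence*, Theory of Computing 8 (2012) 269–289: Thm 1.1, §4 (hypothesis (3)),
  Lemma 4.1, Thm 4.3, §5.  Held text `paper:doi-10-4086-toc-2012-v008a012` (p. 13).
* [Georgiou2010] K. Georgiou, PhD thesis (Toronto 2010), Lemma 8.5.1 (1)–(3), Thm 8.5.3 (held text
  `paper:w2511322911`, p. 174–177).
* [AroraBollobasLovaszTourlakis2006] Theory of Computing 2 (2006), Lemma 2.8 (first moments with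
  alterations).
-/

noncomputable section

open Finset Filter
open Literature.Computability.Complexity (Literal Clause kClauses clauseOf)
open Literature.Computability.MetaComplexity (clauseScope IsCoverExpander cover
  card_clauseScope_of_mem_kClauses card_kClauses clauseScope_subset_range
  card_filter_forall_clauseScope_subset_le)

namespace Literature.Combinatorics.Optimization

variable {k n m : ℕ}

/-! ### Pairs of constraints sharing two variables: the first moment -/

/-- The pairs of positions `s < t` whose scopes share at least two variables (the obstruction to
hypothesis (3) of [BGMT12] §4). [cite: BenabbasGeorgiouMagenTulsiani2012, §4 (p. 13: "conditioned on no two constraints sharing more than one variable")] -/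
def sharedPairs (ω : Fin m → ↥(kClauses k n)) : Finset (Fin m × Fin m) :=
  univ.filter fun st => st.1 < st.2 ∧
    2 ≤ (clauseScope (ω st.1 : Clause ℕ) ∩ clauseScope (ω st.2 : Clause ℕ)).card

/-- **One pair**: for fixed `s < t`, the tuples in which positions `s, t` share `≥ 2` variables
number at most `C(n, 2k−2) · (C(2k−2, k) 2^k)² · |X|^{m−2}` (both scopes lie in a common set of
`2k − 2` variables; `n ≥ 2k`). [cite: BenabbasGeorgiouMagenTulsiani2012, §5 (proof of Lemma 4.1, p. 14: "forbidding any of the k² pairs of variables in the ith constraint from being equal to any of the (i − 1) · k² pairs in the previously chosen ones")] -/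
theorem card_filter_mem_sharedPairs_le (hkn : 2 * k ≤ n) {s t : Fin m} (hst : s < t) :
    ((univ : Finset (Fin m → ↥(kClauses k n))).filter fun ω => (s, t) ∈ sharedPairs ω).card ≤
      n.choose (2 * k - 2) * (((2 * k - 2).choose k * 2 ^ k) ^ 2 *
        (kClauses k n).card ^ (m - 2)) := by
  classical
  set 𝒱 := (Finset.range n).powersetCard (2 * k - 2) with h𝒱
  have hcov : ((univ : Finset (Fin m → ↥(kClauses k n))).filter fun ω => (s, t) ∈ sharedPairs ω) ⊆
      𝒱.biUnion fun V => univ.filter fun ω : Fin m → ↥(kClauses k n) =>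
        ∀ i ∈ ({s, t} : Finset (Fin m)), clauseScope (ω i : Clause ℕ) ⊆ V := by
    intro ω hω
    have hsh := (mem_filter.1 hω).2
    simp only [sharedPairs, mem_filter, mem_univ, true_and] at hsh
    obtain ⟨-, h2⟩ := hsh
    set A := clauseScope (ω s : Clause ℕ) with hA
    set B := clauseScope (ω t : Clause ℕ) with hB
    have hAk : A.card = k := card_clauseScope_of_mem_kClauses (ω s).2
    have hBk : B.card = k := card_clauseScope_of_mem_kClauses (ω t).2
    have hAB : A ∪ B ⊆ Finset.range n :=
      union_subset (clauseScope_subset_range (ω s).2) (clauseScope_subset_range (ω t).2)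
    have hcard : (A ∪ B).card ≤ 2 * k - 2 := by
      have := card_union_add_card_inter A B
      omega
    obtain ⟨V, hABV, hVr, hVcard⟩ :=
      Finset.exists_subsuperset_card_eq hAB hcard (by rw [card_range]; omega)
    refine mem_biUnion.2 ⟨V, mem_powersetCard.2 ⟨hVr, hVcard⟩, mem_filter.2 ⟨mem_univ _, ?_⟩⟩
    intro i hi
    rcases mem_insert.1 hi with rfl | hi
    · exact (subset_union_left).trans hABV
    · rw [mem_singleton] at hi; subst hi
      exact (subset_union_right).trans hABV
  have hst' : ({s, t} : Finset (Fin m)).card = 2 := card_pair (ne_of_lt hst)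
  calc ((univ : Finset (Fin m → ↥(kClauses k n))).filter fun ω => (s, t) ∈ sharedPairs ω).card
      ≤ (𝒱.biUnion fun V => univ.filter fun ω : Fin m → ↥(kClauses k n) =>
          ∀ i ∈ ({s, t} : Finset (Fin m)), clauseScope (ω i : Clause ℕ) ⊆ V).card := card_le_card hcov
    _ ≤ ∑ V ∈ 𝒱, (univ.filter fun ω : Fin m → ↥(kClauses k n) =>
          ∀ i ∈ ({s, t} : Finset (Fin m)), clauseScope (ω i : Clause ℕ) ⊆ V).card := card_biUnion_le
    _ ≤ ∑ V ∈ 𝒱, ((2 * k - 2).choose k * 2 ^ k) ^ 2 * (kClauses k n).card ^ (m - 2) := by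
        refine sum_le_sum fun V hV => ?_
        have hVcard : V.card = 2 * k - 2 := (mem_powersetCard.1 hV).2
        have h := card_filter_forall_clauseScope_subset_le (k := k) (n := n) ({s, t} : Finset (Fin m)) V
        rw [hst', hVcard] at h
        exact h
    _ = n.choose (2 * k - 2) * (((2 * k - 2).choose k * 2 ^ k) ^ 2 *
          (kClauses k n).card ^ (m - 2)) := by
        rw [sum_const, card_powersetCard, card_range, smul_eq_mul]

/-- **The binomial arithmetic**: `n² C(n, 2k−2) C(2k−2, k)² ≤ 64^k (k!)² C(n,k)²` for `n ≥ 2k`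
(`C(n,2k−2) ≤ n^{2k−2}`, `C(2k−2,k) ≤ 4^k`, `C(n,k) ≥ (n/2)^k/k!`).
[cite: BenabbasGeorgiouMagenTulsiani2012, §5 (proof of Lemma 4.1, p. 14: each new constraint shares two variables with an earlier one with probability "O(i · k⁴/n²)")] -/
theorem choose_arith (hk : 1 ≤ k) (hkn : 2 * k ≤ n) :
    (n : ℝ) ^ 2 * (n.choose (2 * k - 2) : ℝ) * ((2 * k - 2).choose k : ℝ) ^ 2 ≤
      (64 : ℝ) ^ k * (k.factorial : ℝ) ^ 2 * (n.choose k : ℝ) ^ 2 := by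
  have hn0 : (0 : ℝ) < n := by exact_mod_cast (by omega : 0 < n)
  have hkf : (0 : ℝ) < k.factorial := by exact_mod_cast Nat.factorial_pos k
  -- `C(n,2k−2) ≤ n^{2k−2}` and `n² n^{2k−2} = n^{2k}`
  have h1 : (n.choose (2 * k - 2) : ℝ) ≤ (n : ℝ) ^ (2 * k - 2) := by
    exact_mod_cast Nat.choose_le_pow n (2 * k - 2)
  have h1' : (n : ℝ) ^ 2 * (n : ℝ) ^ (2 * k - 2) = (n : ℝ) ^ (2 * k) := by
    rw [← pow_add]; congr 1; omega
  -- `C(2k−2,k) ≤ 2^{2k−2} ≤ 4^k`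
  have h2 : ((2 * k - 2).choose k : ℝ) ≤ (4 : ℝ) ^ k := by
    have h := Nat.choose_le_two_pow (2 * k - 2) k
    have h' : ((2 * k - 2).choose k : ℝ) ≤ (2 : ℝ) ^ (2 * k - 2) := by exact_mod_cast h
    refine h'.trans ?_
    calc (2 : ℝ) ^ (2 * k - 2) ≤ 2 ^ (2 * k) := pow_le_pow_right₀ (by norm_num) (by omega)
      _ = 4 ^ k := by rw [pow_mul]; norm_num
  -- `C(n,k) ≥ (n/2)^k / k!`
  have h3 : ((n : ℝ) / 2) ^ k / k.factorial ≤ (n.choose k : ℝ) := by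
    have h := Nat.pow_le_choose (α := ℝ) k n
    refine le_trans ?_ h
    gcongr
    have : (n : ℝ) / 2 ≤ ((n + 1 - k : ℕ) : ℝ) := by
      rw [Nat.cast_sub (by omega)]; push_cast
      have : (2 * k : ℝ) ≤ n := by exact_mod_cast hkn
      linarith
    exact this
  have h3' : (n : ℝ) ^ (2 * k) ≤ (4 : ℝ) ^ k * (k.factorial : ℝ) ^ 2 * (n.choose k : ℝ) ^ 2 := by
    have h4 : (((n : ℝ) / 2) ^ k / k.factorial) ^ 2 ≤ (n.choose k : ℝ) ^ 2 :=
      pow_le_pow_left₀ (by positivity) h3 2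
    have e : (((n : ℝ) / 2) ^ k / k.factorial) ^ 2 * ((4 : ℝ) ^ k * (k.factorial : ℝ) ^ 2) =
        (n : ℝ) ^ (2 * k) := by
      field_simp
      rw [show (4 : ℝ) = 2 ^ 2 by norm_num, ← pow_mul, div_pow, ← pow_mul, mul_comm k 2]
      field_simp
    calc (n : ℝ) ^ (2 * k) = (((n : ℝ) / 2) ^ k / k.factorial) ^ 2 * ((4 : ℝ) ^ k * (k.factorial : ℝ) ^ 2) :=
          e.symm
      _ ≤ (n.choose k : ℝ) ^ 2 * ((4 : ℝ) ^ k * (k.factorial : ℝ) ^ 2) :=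
          mul_le_mul_of_nonneg_right h4 (by positivity)
      _ = (4 : ℝ) ^ k * (k.factorial : ℝ) ^ 2 * (n.choose k : ℝ) ^ 2 := by ring
  calc (n : ℝ) ^ 2 * (n.choose (2 * k - 2) : ℝ) * ((2 * k - 2).choose k : ℝ) ^ 2
      ≤ (n : ℝ) ^ 2 * (n : ℝ) ^ (2 * k - 2) * ((4 : ℝ) ^ k) ^ 2 := by gcongr
    _ = (n : ℝ) ^ (2 * k) * (16 : ℝ) ^ k := by
        rw [h1']; congr 1; rw [sq, ← mul_pow]; norm_num
    _ ≤ ((4 : ℝ) ^ k * (k.factorial : ℝ) ^ 2 * (n.choose k : ℝ) ^ 2) * (16 : ℝ) ^ k :=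
        mul_le_mul_of_nonneg_right h3' (by positivity)
    _ = (64 : ℝ) ^ k * (k.factorial : ℝ) ^ 2 * (n.choose k : ℝ) ^ 2 := by
        rw [show (64 : ℝ) = 4 * 16 by norm_num, mul_pow]; ring

/-- **The first moment of the shared pairs**: `Σ_ω |sharedPairs ω| ≤ ∆² K₀ |X|^m` for `m = ∆n`,
`n ≥ 2k`, `K₀ = 64^k (k!)²` (the expected number of pairs of constraints sharing two variables is
`O(k⁴γ²)`). [cite: BenabbasGeorgiouMagenTulsiani2012, Lemma 4.1 (p. 13: "with probability exp(−O(k⁴γ²))") and §5 (p. 14: "the probability that there are no two constraints sharing two variables must be at least ∏_{i=1,…,m} (1 − O(i · k⁴/n²))")] -/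
theorem sum_card_sharedPairs_le (hk : 3 ≤ k) {Δ : ℕ} (hΔ : 1 ≤ Δ) (hkn : 2 * k ≤ n) (hm : m = Δ * n) :
    ∑ ω : Fin m → ↥(kClauses k n), ((sharedPairs ω).card : ℝ) ≤
      (Δ : ℝ) ^ 2 * ((64 : ℝ) ^ k * (k.factorial : ℝ) ^ 2) * ((kClauses k n).card : ℝ) ^ m := by
  classical
  set X := ↥(kClauses k n)
  set N : ℝ := ((kClauses k n).card : ℝ) with hN
  have hn1 : 1 ≤ n := by omega
  have hkn' : k ≤ n := by omega
  have hKc : (kClauses k n).card = n.choose k * 2 ^ k := card_kClauses k n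
  have hNpos : 0 < N := by
    rw [hN, hKc]; exact_mod_cast Nat.mul_pos (Nat.choose_pos hkn') (by positivity)
  have hm2 : 2 ≤ m := by rw [hm]; nlinarith
  -- exchange the sums
  have hswap : ∑ ω : Fin m → X, ((sharedPairs ω).card : ℝ) =
      ∑ st : Fin m × Fin m, (((univ : Finset (Fin m → X)).filter fun ω => st ∈ sharedPairs ω).card : ℝ) := by
    have h1 : ∀ ω : Fin m → X, ((sharedPairs ω).card : ℝ) =
        ∑ st : Fin m × Fin m, if st ∈ sharedPairs ω then (1 : ℝ) else 0 := fun ω => by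
      rw [Finset.sum_boole, Finset.filter_mem_eq_inter, univ_inter]
    have h2 : ∀ st : Fin m × Fin m,
        (((univ : Finset (Fin m → X)).filter fun ω => st ∈ sharedPairs ω).card : ℝ) =
        ∑ ω : Fin m → X, if st ∈ sharedPairs ω then (1 : ℝ) else 0 := fun st => by
      rw [Finset.sum_boole]
    simp_rw [h1, h2]
    exact Finset.sum_comm
  rw [hswap]
  -- bound each pair
  set B : ℝ := (n.choose (2 * k - 2) : ℝ) * ((((2 * k - 2).choose k * 2 ^ k : ℕ) : ℝ) ^ 2 *
    N ^ (m - 2)) with hB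
  have hB0 : 0 ≤ B := by rw [hB]; positivity
  have hpair : ∀ st : Fin m × Fin m,
      (((univ : Finset (Fin m → X)).filter fun ω => st ∈ sharedPairs ω).card : ℝ) ≤ B := by
    rintro ⟨s, t⟩
    by_cases hst : s < t
    · have h := card_filter_mem_sharedPairs_le (m := m) hkn hst
      have h' : ((((univ : Finset (Fin m → X)).filter fun ω => (s, t) ∈ sharedPairs ω).card : ℕ) : ℝ) ≤
          ((n.choose (2 * k - 2) * (((2 * k - 2).choose k * 2 ^ k) ^ 2 *
            (kClauses k n).card ^ (m - 2)) : ℕ) : ℝ) := by exact_mod_cast h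
      refine h'.trans (le_of_eq ?_)
      rw [hB, hN]; push_cast; ring
    · have hempty : ((univ : Finset (Fin m → X)).filter fun ω => (s, t) ∈ sharedPairs ω) = ∅ := by
        refine filter_eq_empty_iff.2 fun ω _ hmem => ?_
        simp only [sharedPairs, mem_filter, mem_univ, true_and] at hmem
        exact hst hmem.1
      rw [hempty, card_empty]; exact_mod_cast hB0
  have hsum : ∑ st : Fin m × Fin m,
      (((univ : Finset (Fin m → X)).filter fun ω => st ∈ sharedPairs ω).card : ℝ) ≤ (m : ℝ) ^ 2 * B := by
    calc _ ≤ ∑ _st : Fin m × Fin m, B := sum_le_sum fun st _ => hpair st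
      _ = (m : ℝ) ^ 2 * B := by
          rw [sum_const, card_univ, Fintype.card_prod, Fintype.card_fin, nsmul_eq_mul]; push_cast; ring
  refine hsum.trans ?_
  -- the arithmetic: `m² B ≤ ∆² K₀ N^m`
  have harith := choose_arith (k := k) (n := n) (by omega) hkn
  have hNm : N ^ m = N ^ (m - 2) * N ^ 2 := by rw [← pow_add]; congr 1; omega
  have hNsq : N ^ 2 = (n.choose k : ℝ) ^ 2 * (4 : ℝ) ^ k := by
    rw [hN, hKc]; push_cast
    rw [mul_pow, ← pow_mul, mul_comm k 2, pow_mul]; norm_num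
  have hmr : (m : ℝ) = Δ * n := by rw [hm]; push_cast; ring
  rw [hNm, hNsq, hB, hmr]
  push_cast
  have hNm2 : 0 ≤ N ^ (m - 2) := by positivity
  have h4k : (0 : ℝ) < (4 : ℝ) ^ k := by positivity
  -- compare the `n`-dependent factors
  have key : (n : ℝ) ^ 2 * (n.choose (2 * k - 2) : ℝ) * (((2 * k - 2).choose k : ℝ) * (2 : ℝ) ^ k) ^ 2 ≤
      (64 : ℝ) ^ k * (k.factorial : ℝ) ^ 2 * ((n.choose k : ℝ) ^ 2 * (4 : ℝ) ^ k) := by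
    have e1 : (((2 * k - 2).choose k : ℝ) * (2 : ℝ) ^ k) ^ 2 =
        ((2 * k - 2).choose k : ℝ) ^ 2 * (4 : ℝ) ^ k := by
      rw [mul_pow, ← pow_mul, mul_comm k 2, pow_mul]; norm_num
    rw [e1]
    calc (n : ℝ) ^ 2 * (n.choose (2 * k - 2) : ℝ) * (((2 * k - 2).choose k : ℝ) ^ 2 * (4 : ℝ) ^ k)
        = ((n : ℝ) ^ 2 * (n.choose (2 * k - 2) : ℝ) * ((2 * k - 2).choose k : ℝ) ^ 2) * (4 : ℝ) ^ k := by
          ring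
      _ ≤ ((64 : ℝ) ^ k * (k.factorial : ℝ) ^ 2 * (n.choose k : ℝ) ^ 2) * (4 : ℝ) ^ k :=
          mul_le_mul_of_nonneg_right harith h4k.le
      _ = _ := by ring
  calc ((Δ : ℝ) * n) ^ 2 * ((n.choose (2 * k - 2) : ℝ) *
        ((((2 * k - 2).choose k : ℝ) * (2 : ℝ) ^ k) ^ 2 * N ^ (m - 2)))
      = (Δ : ℝ) ^ 2 * N ^ (m - 2) *
          ((n : ℝ) ^ 2 * (n.choose (2 * k - 2) : ℝ) * (((2 * k - 2).choose k : ℝ) * (2 : ℝ) ^ k) ^ 2) := by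
        ring
    _ ≤ (Δ : ℝ) ^ 2 * N ^ (m - 2) *
          ((64 : ℝ) ^ k * (k.factorial : ℝ) ^ 2 * ((n.choose k : ℝ) ^ 2 * (4 : ℝ) ^ k)) :=
        mul_le_mul_of_nonneg_left key (by positivity)
    _ = (Δ : ℝ) ^ 2 * ((64 : ℝ) ^ k * (k.factorial : ℝ) ^ 2) *
          (N ^ (m - 2) * ((n.choose k : ℝ) ^ 2 * (4 : ℝ) ^ k)) := by ring

/-- **Markov**: at most a third of the tuples have `≥ 3∆²K₀` shared pairs.
[cite: BenabbasGeorgiouMagenTulsiani2012, Lemma 4.1 (p. 13) and §5 (p. 14)] [cite: AroraBollobasLovaszTourlakis2006, Lemma 2.8 proof (p. 27: "by Markov's inequality")] -/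
theorem card_manyShared_le (hk : 3 ≤ k) {Δ : ℕ} (hΔ : 1 ≤ Δ) (hkn : 2 * k ≤ n) (hm : m = Δ * n)
    (bad : Finset (Fin m → ↥(kClauses k n)))
    (hbad : ∀ ω ∈ bad,
      3 * (Δ : ℝ) ^ 2 * ((64 : ℝ) ^ k * (k.factorial : ℝ) ^ 2) ≤ ((sharedPairs ω).card : ℝ)) :
    (bad.card : ℝ) ≤ 1 / 3 * ((kClauses k n).card : ℝ) ^ m := by
  classical
  set L : ℝ := 3 * (Δ : ℝ) ^ 2 * ((64 : ℝ) ^ k * (k.factorial : ℝ) ^ 2) with hL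
  have hLpos : 0 < L := by
    rw [hL]; have : (0 : ℝ) < Δ := by exact_mod_cast hΔ
    positivity
  have hsub : bad ⊆ (univ : Finset (Fin m → ↥(kClauses k n))).filter fun ω =>
      L ≤ ((sharedPairs ω).card : ℝ) := fun ω hω => mem_filter.2 ⟨mem_univ _, hbad ω hω⟩
  have hcard : (bad.card : ℝ) ≤ ((((univ : Finset (Fin m → ↥(kClauses k n))).filter fun ω =>
      L ≤ ((sharedPairs ω).card : ℝ)).card : ℕ) : ℝ) := by exact_mod_cast card_le_card hsub
  have hmarkov := RandomPairs.card_filter_mul_le_sum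
    (fun ω : Fin m → ↥(kClauses k n) => ((sharedPairs ω).card : ℝ)) (fun _ => Nat.cast_nonneg _) L
  have hsum := sum_card_sharedPairs_le (m := m) hk hΔ hkn hm
  have h : ((((univ : Finset (Fin m → ↥(kClauses k n))).filter fun ω =>
      L ≤ ((sharedPairs ω).card : ℝ)).card : ℝ)) * L ≤
      (1 / 3 * ((kClauses k n).card : ℝ) ^ m) * L := by
    refine (hmarkov.trans hsum).trans (le_of_eq ?_)
    rw [hL]; ring
  exact hcard.trans (le_of_mul_le_mul_right h hLpos)

/-! ### The alteration: deleting the later member of every shared pair -/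

/-- The kept positions: `t` with no earlier `s` sharing two variables with it.
[cite: BenabbasGeorgiouMagenTulsiani2012, §4 (hypothesis (3))] -/
def keep (ω : Fin m → ↥(kClauses k n)) : Finset (Fin m) :=
  univ.filter fun t => ∀ s : Fin m, s < t →
    (clauseScope (ω s : Clause ℕ) ∩ clauseScope (ω t : Clause ℕ)).card ≤ 1

/-- The sub-tuple on the kept positions (in increasing order). [cite: BenabbasGeorgiouMagenTulsiani2012, §4] -/
def subTuple (ω : Fin m → ↥(kClauses k n)) : Fin (keep ω).card → ↥(kClauses k n) :=
  fun i => ω ((keep ω).orderEmbOfFin rfl i)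

/-- **Hypothesis (3) holds for the sub-tuple**: any two of its constraints share at most one variable.
[cite: BenabbasGeorgiouMagenTulsiani2012, §4 (p. 13: "no two constraints sharing more than one variable")] -/
theorem subTuple_pairwise (ω : Fin m → ↥(kClauses k n)) :
    ∀ a b : Fin (keep ω).card, a ≠ b →
      (clauseScope (subTuple ω a : Clause ℕ) ∩ clauseScope (subTuple ω b : Clause ℕ)).card ≤ 1 := by
  classical
  intro a b hab
  set ι := (keep ω).orderEmbOfFin rfl with hι
  have hne : ι a ≠ ι b := fun h => hab (ι.injective h)
  have hka : ι a ∈ keep ω := Finset.orderEmbOfFin_mem _ _ a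
  have hkb : ι b ∈ keep ω := Finset.orderEmbOfFin_mem _ _ b
  unfold subTuple
  rcases lt_or_gt_of_ne hne with h | h
  · exact (mem_filter.1 hkb).2 (ι a) h
  · rw [inter_comm]
    exact (mem_filter.1 hka).2 (ι b) h

/-- **The deleted positions are at most the shared pairs** (each deleted `t` is the later member of
a shared pair). [cite: BenabbasGeorgiouMagenTulsiani2012, §4] -/
theorem card_compl_keep_le (ω : Fin m → ↥(kClauses k n)) :
    (univ \ keep ω).card ≤ (sharedPairs ω).card := by
  classical
  have hsub : univ \ keep ω ⊆ (sharedPairs ω).image Prod.snd := by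
    intro t ht
    have h := (Finset.mem_sdiff.1 ht).2
    simp only [keep, mem_filter, mem_univ, true_and, not_forall, not_le] at h
    obtain ⟨s, hs, hcard⟩ := h
    refine mem_image.2 ⟨(s, t), ?_, rfl⟩
    simp only [sharedPairs, mem_filter, mem_univ, true_and]
    exact ⟨hs, by omega⟩
  exact (card_le_card hsub).trans card_image_le

/-- Hence the sub-tuple keeps at least `m − |sharedPairs|` positions. [cite: BenabbasGeorgiouMagenTulsiani2012, §4] -/
theorem card_keep_ge (ω : Fin m → ↥(kClauses k n)) :
    m ≤ (keep ω).card + (sharedPairs ω).card := by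
  classical
  have h1 := card_compl_keep_le ω
  have h2 : (univ \ keep ω).card + (keep ω).card = m := by
    rw [card_sdiff_add_card_eq_card (subset_univ _), card_univ, Fintype.card_fin]
  omega

/-- **Cover expansion is inherited by sub-tuples** (a subfamily of the scope family).
[cite: Georgiou2010, Def. 8.1.1 (p. 163)] -/
theorem isCoverExpander_subTuple {ω : Fin m → ↥(kClauses k n)} {r a : ℝ}
    (h : IsCoverExpander (fun i => clauseScope (ω i : Clause ℕ)) r a) :
    IsCoverExpander (fun i => clauseScope (subTuple ω i : Clause ℕ)) r a := by
  classical
  intro F hF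
  set ι := (keep ω).orderEmbOfFin rfl with hι
  have hcard : (F.map ι.toEmbedding).card = F.card := card_map _
  have h1 := h (F.map ι.toEmbedding) (by rw [hcard]; exact hF)
  rw [hcard] at h1
  have hcov : cover (fun i => clauseScope (subTuple ω i : Clause ℕ)) F =
      cover (fun i => clauseScope (ω i : Clause ℕ)) (F.map ι.toEmbedding) := by
    ext v
    rw [Literature.Computability.MetaComplexity.mem_cover,
      Literature.Computability.MetaComplexity.mem_cover]
    constructor
    · rintro ⟨i, hi, hv⟩
      exact ⟨ι i, Finset.mem_map.2 ⟨i, hi, rfl⟩, hv⟩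
    · rintro ⟨j, hj, hv⟩
      obtain ⟨i, hi, rfl⟩ := Finset.mem_map.1 hj
      exact ⟨i, hi, hv⟩
  rw [hcov]
  exact h1

/-- **Every assignment satisfies at most as many constraints of the sub-tuple** as of the tuple.
[cite: BenabbasGeorgiouMagenTulsiani2012, §4] -/
theorem card_sat_subTuple_le (P : (Fin k → Bool) → Bool) (ω : Fin m → ↥(kClauses k n))
    (x : Fin n → Bool) :
    (univ.filter fun i : Fin (keep ω).card => (predConstraintK P (subTuple ω i)).sat x = true).card ≤
      (univ.filter fun i : Fin m => (predConstraintK P (ω i)).sat x = true).card := by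
  classical
  set ι := (keep ω).orderEmbOfFin rfl with hι
  refine Finset.card_le_card_of_injOn (fun i => ι i) (fun i hi => ?_) (fun i _ j _ h => ι.injective h)
  have := (mem_filter.1 hi).2
  exact mem_coe.2 (mem_filter.2 ⟨mem_univ _, this⟩)

/-! ### Lemma 8.5.1 / [BGMT12] Lemma 4.1 with hypothesis (3) -/

/-- The arithmetic of the alteration: losing `≤ L` of `M` constraints costs at most `ε/2` in the
value bound once `3L + 2 ≤ (ε/2) M`. [cite: BenabbasGeorgiouMagenTulsiani2012, §4] -/
theorem alteration_arith {p e M m' L : ℝ} (hp0 : 0 ≤ p) (hp1 : p ≤ 1) (he0 : 0 < e)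
    (he1 : e ≤ 1) (hL0 : 0 < L) (hM0 : 0 ≤ M) (hm' : M - L ≤ m') (hM : 3 * L + 2 ≤ e * M) :
    (p + e) * M ≤ (p + 2 * e) * m' ∧ 1 ≤ m' := by
  have hpe3 : p + 2 * e ≤ 3 := by linarith
  have hpe0 : 0 ≤ p + 2 * e := by linarith
  have hA : (p + 2 * e) * (M - L) ≤ (p + 2 * e) * m' := mul_le_mul_of_nonneg_left hm' hpe0
  have hB : (p + 2 * e) * L ≤ 3 * L := mul_le_mul_of_nonneg_right hpe3 hL0.le
  have hC : e * M ≤ M := mul_le_of_le_one_left hM0 he1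
  constructor
  · have e1 : (p + 2 * e) * (M - L) = (p + e) * M + e * M - (p + 2 * e) * L := by ring
    rw [e1] at hA
    linarith
  · linarith

set_option maxHeartbeats 400000 in -- buildfix (bf3-g30): 160k/180k FAIL, 200k PASS at accept time; line-neutral budget line
/-- **Lemma 8.5.1 (1),(2),(3) / [BGMT12] Lemma 4.1, with hypothesis (3) by alteration:** for
`k ≥ 3`, a predicate `P` and `0 < ε ≤ 1` there are `∆ ≥ 1`, `κ > 0` and `n₀` such that for every
`n ≥ n₀` some tuple of `m` clauses (`1 ≤ m ≤ ∆n`) on `n` variables is a `(⌊κn⌋, k − 9/8)`-cover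
expander, has pairwise scope intersections of size `≤ 1`, and no assignment satisfies more than
`(|P⁻¹(1)|/2^k + ε)m` of its `P`-constraints.  (Three-event union bound on the tuples of `∆n` clauses
— expansion and value as in `exists_strong_predTupleK` at `ε/2`, and fewer than `3∆²K₀` shared pairs
by Markov — then delete the later member of every shared pair.)
[cite: Georgiou2010, Lemma 8.5.1 (p. 174)] [cite: BenabbasGeorgiouMagenTulsiani2012, Lemma 4.1 and §5] -/
theorem exists_strong_predTupleK3 (hk : 3 ≤ k) (P : (Fin k → Bool) → Bool) {ε : ℝ} (hε0 : 0 < ε)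
    (hε1 : ε ≤ 1) :
    ∃ Δ : ℕ, 1 ≤ Δ ∧ ∃ κ : ℝ, 0 < κ ∧ ∃ n₀ : ℕ, ∀ n : ℕ, n₀ ≤ n →
      ∃ m : ℕ, 1 ≤ m ∧ m ≤ Δ * n ∧ ∃ ω : Fin m → ↥(kClauses k n),
        IsCoverExpander (fun i => clauseScope (ω i).1) (⌊κ * n⌋₊ : ℕ) ((k : ℝ) - 9 / 8) ∧
        (∀ a b : Fin m, a ≠ b → (clauseScope (ω a).1 ∩ clauseScope (ω b).1).card ≤ 1) ∧
        (∀ x : Fin n → Bool, ((univ.filter fun i : Fin m =>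
            (predConstraintK P (ω i)).sat x = true).card : ℝ) ≤
          ((((univ : Finset (Fin k → Bool)).filter fun y => P y = true).card / 2 ^ k : ℝ) + ε) * m) := by
  classical
  set NP := ((univ : Finset (Fin k → Bool)).filter fun y => P y = true).card with hNP
  have hNPle : NP ≤ 2 ^ k := by
    have := Finset.card_filter_le (univ : Finset (Fin k → Bool)) (fun y => P y = true)
    rwa [card_univ, Fintype.card_fun, Fintype.card_bool, Fintype.card_fin] at this
  set p : ℝ := (NP : ℝ) / 2 ^ k with hp
  have h2k : (0 : ℝ) < 2 ^ k := by positivity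
  have hp0 : 0 ≤ p := by rw [hp]; positivity
  have hp1 : p ≤ 1 := by
    rw [hp, div_le_one h2k]; exact_mod_cast hNPle
  -- the parameters of the two classical events, at `ε/2`
  set ε₂ : ℝ := ε / 2 with hε₂
  have hε₂0 : 0 < ε₂ := by rw [hε₂]; linarith
  have hε₂1 : ε₂ ≤ 1 := by rw [hε₂]; linarith
  set Δ : ℕ := ⌈2 ^ (k + 1) / ε₂ ^ 2⌉₊ with hΔdef
  have hΔge : (2 : ℝ) ^ (k + 1) / ε₂ ^ 2 ≤ (Δ : ℝ) := Nat.le_ceil _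
  have hε2sq : 0 < ε₂ ^ 2 := by positivity
  have hΔ1 : 1 ≤ Δ := by
    have h2k1 : (1 : ℝ) ≤ 2 ^ (k + 1) := one_le_pow₀ (by norm_num)
    have : (1 : ℝ) ≤ 2 ^ (k + 1) / ε₂ ^ 2 := by
      rw [le_div_iff₀ hε2sq]; nlinarith
    have h : (1 : ℝ) ≤ Δ := by linarith
    exact_mod_cast h
  have hΔ1r : (1 : ℝ) ≤ Δ := by exact_mod_cast hΔ1
  have hk3 : (3 : ℝ) ≤ k := by exact_mod_cast hk
  set a : ℝ := (k : ℝ) - 9 / 8 with ha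
  have hapos : 0 < a := by rw [ha]; linarith
  set B : ℝ := Real.exp 1 * Δ * a * Real.exp a with hB
  have hBpos : 0 < B := by rw [hB]; positivity
  set κ : ℝ := 1 / (a * (4 * B) ^ 8) with hκ
  have hκpos : 0 < κ := by rw [hκ]; positivity
  -- the threshold of the third event
  set K₀ : ℝ := (64 : ℝ) ^ k * (k.factorial : ℝ) ^ 2 with hK₀
  set L : ℝ := 3 * (Δ : ℝ) ^ 2 * K₀ with hL
  have hL0 : 0 < L := by rw [hL, hK₀]; positivity
  refine ⟨Δ, hΔ1, κ, hκpos, max (2 * k) ⌈(3 * L + 2) / (ε₂ * Δ)⌉₊, fun n hn => ?_⟩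
  have hkn : 2 * k ≤ n := le_of_max_le_left hn
  have hkn' : k ≤ n := by omega
  have hn1 : 1 ≤ n := by omega
  have hnr : (0 : ℝ) < n := by exact_mod_cast hn1
  have hnL : (3 * L + 2) / (ε₂ * Δ) ≤ n := by
    have := le_of_max_le_right hn
    exact (Nat.le_ceil _).trans (by exact_mod_cast this)
  have hnL' : 3 * L + 2 ≤ ε₂ * Δ * n := by
    rw [div_le_iff₀ (by positivity)] at hnL
    linarith
  -- the clause space
  have hKc : (kClauses k n).card = n.choose k * 2 ^ k := card_kClauses k n
  have hK : (kClauses k n).Nonempty := by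
    rw [← Finset.card_pos, hKc]
    exact Nat.mul_pos (Nat.choose_pos hkn') (by positivity)
  set X := ↥(kClauses k n)
  set M := Δ * n with hM
  have hcardX : (Fintype.card X : ℝ) = (kClauses k n).card := by rw [Fintype.card_coe]
  set T : ℝ := ((kClauses k n).card : ℝ) ^ M with hT
  have hTpos : 0 < T := by rw [hT]; exact pow_pos (by exact_mod_cast Finset.card_pos.2 hK) _
  -- the three bad sets
  set badExp : Finset (Fin M → X) := univ.filter fun ω =>
    ¬ IsCoverExpander (fun i => clauseScope (ω i).1) (⌊κ * n⌋₊ : ℕ) ((k : ℝ) - 9 / 8) with hbadExp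
  set badVal : Finset (Fin M → X) := univ.filter fun ω => ∃ σ : Fin n → Bool,
    (p + ε₂) * M < ((univ.filter fun i => (predConstraintK P (ω i)).sat σ = true).card : ℝ)
    with hbadVal
  set badSh : Finset (Fin M → X) := univ.filter fun ω =>
    3 * (Δ : ℝ) ^ 2 * ((64 : ℝ) ^ k * (k.factorial : ℝ) ^ 2) ≤ ((sharedPairs ω).card : ℝ) with hbadSh
  -- (1) expansion failures
  have h1 : (badExp.card : ℝ) ≤ T / 3 := by
    have hN : a * (⌊κ * n⌋₊ : ℕ) ≤ n / (4 * B) ^ 8 := by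
      have hf : ((⌊κ * n⌋₊ : ℕ) : ℝ) ≤ κ * n := Nat.floor_le (by positivity)
      have : a * (κ * n) = n / (4 * B) ^ 8 := by
        rw [hκ]; field_simp
      calc a * (⌊κ * n⌋₊ : ℕ) ≤ a * (κ * n) := by gcongr
        _ = n / (4 * B) ^ 8 := this
    have h := card_le_of_forall_not_isCoverExpander_strong (k := k) (Δ := Δ) (n := n)
      (N := ⌊κ * n⌋₊) (a := a) (B := B) hk hΔ1 hn1 hK ha hB hN badExp
      (fun c hc => (Finset.mem_filter.1 hc).2)
    calc (badExp.card : ℝ) ≤ 1 / 3 * ((((kClauses k n).card ^ (Δ * n) : ℕ)) : ℝ) := h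
      _ = T / 3 := by rw [hT, hM]; push_cast; ring
  -- (2) value failures
  have h2 : (badVal.card : ℝ) ≤ 2 / 7 * T := by
    rcases Nat.lt_or_ge NP (2 ^ k) with hlt | hge
    · have hp' : p ≤ 1 - 1 / 2 ^ k := by
        have h1' : (NP : ℝ) ≤ 2 ^ k - 1 := by
          have : NP + 1 ≤ 2 ^ k := hlt
          have h'' : ((NP + 1 : ℕ) : ℝ) ≤ ((2 ^ k : ℕ) : ℝ) := by exact_mod_cast this
          push_cast at h''; linarith
        rw [hp, div_le_iff₀ h2k, sub_mul, one_mul, div_mul_cancel₀ _ h2k.ne']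
        exact h1'
      have h := card_filter_exists_manyGood_le (n := n) (X := X)
        (fun σ C => (predConstraintK P C).sat σ = true)
        (p := p) (ε := ε₂) hp0 (fun σ => card_filter_predGoodK_le P σ) hε₂0.le hε₂1 M
      rw [hcardX] at h
      have hq : (2 : ℝ) ≤ (1 - p) * ε₂ ^ 2 * Δ := by
        have : (2 : ℝ) ^ (k + 1) ≤ ε₂ ^ 2 * Δ := by
          calc (2 : ℝ) ^ (k + 1) = ε₂ ^ 2 * (2 ^ (k + 1) / ε₂ ^ 2) := by field_simp
            _ ≤ ε₂ ^ 2 * Δ := by gcongr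
        have h1p : 1 / 2 ^ k ≤ 1 - p := by linarith
        have h1p0 : (0 : ℝ) ≤ 1 - p := le_trans (by positivity) h1p
        calc (2 : ℝ) = 1 / 2 ^ k * 2 ^ (k + 1) := by field_simp; ring
          _ ≤ (1 - p) * (ε₂ ^ 2 * Δ) := by gcongr
          _ = (1 - p) * ε₂ ^ 2 * Δ := by ring
      have h2n := two_pow_mul_exp_neg_two_mul_le hn1
      have hexple : Real.exp (-((1 - p) * ε₂ ^ 2 * (M : ℕ))) ≤ Real.exp (-(2 * n)) := by
        rw [Real.exp_le_exp, hM]; push_cast; nlinarith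
      have h3 : (2 : ℝ) ^ n * Real.exp (-((1 - p) * ε₂ ^ 2 * (M : ℕ))) ≤ 2 / 7 :=
        le_trans (by gcongr) h2n
      calc (badVal.card : ℝ) ≤ 2 ^ n * (((kClauses k n).card : ℝ) ^ M *
            Real.exp (-((1 - p) * ε₂ ^ 2 * M))) := h
        _ = 2 ^ n * Real.exp (-((1 - p) * ε₂ ^ 2 * (M : ℕ))) * T := by rw [hT]; ring
        _ ≤ 2 / 7 * T := mul_le_mul_of_nonneg_right h3 hTpos.le
    · have hp1' : p = 1 := by
        have : NP = 2 ^ k := le_antisymm hNPle hge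
        rw [hp, this]; push_cast; field_simp
      have hempty : badVal = ∅ := by
        rw [hbadVal, Finset.filter_eq_empty_iff]
        intro ω _ ⟨σ, hσ⟩
        have hle : ((univ.filter fun i => (predConstraintK P (ω i)).sat σ = true).card : ℝ) ≤ M := by
          have := Finset.card_filter_le (univ : Finset (Fin M))
            (fun i => (predConstraintK P (ω i)).sat σ = true)
          rw [Finset.card_univ, Fintype.card_fin] at this
          exact_mod_cast this
        have hm0 : (0 : ℝ) ≤ M := Nat.cast_nonneg _
        rw [hp1'] at hσ
        nlinarith
      rw [hempty, Finset.card_empty]; push_cast; positivity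
  -- (3) many shared pairs
  have h3 : (badSh.card : ℝ) ≤ 1 / 3 * T := by
    have h := card_manyShared_le (m := M) hk hΔ1 hkn hM badSh
      (fun ω hω => (Finset.mem_filter.1 hω).2)
    rw [hT]; exact h
  -- a tuple outside the three bad sets
  have hlt : ((badExp ∪ badVal ∪ badSh).card : ℝ) < (univ : Finset (Fin M → X)).card := by
    have hU : ((univ : Finset (Fin M → X)).card : ℝ) = T := by
      rw [Finset.card_univ, Fintype.card_fun, Fintype.card_fin, hT, Nat.cast_pow, hcardX]
    have hu : ((badExp ∪ badVal ∪ badSh).card : ℝ) ≤ badExp.card + badVal.card + badSh.card := by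
      have e1 : ((badExp ∪ badVal ∪ badSh).card : ℝ) ≤ (badExp ∪ badVal).card + badSh.card := by
        exact_mod_cast Finset.card_union_le _ _
      have e2 : ((badExp ∪ badVal).card : ℝ) ≤ badExp.card + badVal.card := by
        exact_mod_cast Finset.card_union_le _ _
      linarith
    rw [hU]
    linarith
  have hne : ((univ : Finset (Fin M → X)) \ (badExp ∪ badVal ∪ badSh)).Nonempty := by
    rw [Finset.nonempty_iff_ne_empty]
    intro h
    have := Finset.card_sdiff_add_card_eq_card (Finset.subset_univ (badExp ∪ badVal ∪ badSh))
    rw [h, Finset.card_empty, zero_add] at this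
    rw [this] at hlt
    exact lt_irrefl _ hlt
  obtain ⟨ω, hω⟩ := hne
  rw [Finset.mem_sdiff, Finset.mem_union, Finset.mem_union, not_or, not_or] at hω
  obtain ⟨-, ⟨hωE, hωV⟩, hωS⟩ := hω
  have hexp : IsCoverExpander (fun i => clauseScope (ω i).1) (⌊κ * n⌋₊ : ℕ) ((k : ℝ) - 9 / 8) := by
    by_contra hc
    exact hωE (Finset.mem_filter.2 ⟨Finset.mem_univ _, hc⟩)
  have hval : ∀ x : Fin n → Bool,
      ((univ.filter fun i : Fin M => (predConstraintK P (ω i)).sat x = true).card : ℝ) ≤ (p + ε₂) * M := by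
    intro x
    by_contra hc
    push Not at hc
    exact hωV (Finset.mem_filter.2 ⟨Finset.mem_univ _, x, hc⟩)
  have hsh : ((sharedPairs ω).card : ℝ) < L := by
    by_contra hc
    push Not at hc
    exact hωS (Finset.mem_filter.2 ⟨Finset.mem_univ _, by rw [hL, hK₀] at hc; exact hc⟩)
  -- the alteration
  set m' := (keep ω).card with hm'
  have hm'le : m' ≤ M := by
    have := card_le_univ (keep ω)
    rwa [Fintype.card_fin] at this
  have hm'ge : (M : ℝ) - L ≤ (m' : ℝ) := by
    have h := card_keep_ge ω
    have h' : (M : ℝ) ≤ (m' : ℝ) + (sharedPairs ω).card := by exact_mod_cast h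
    linarith only [h', hsh]
  have hMr : (M : ℝ) = Δ * n := by rw [hM]; push_cast; ring
  have hM3 : 3 * L + 2 ≤ ε₂ * (M : ℝ) :=
    calc 3 * L + 2 ≤ ε₂ * Δ * n := hnL'
      _ = ε₂ * (M : ℝ) := by rw [hMr]; ring
  obtain ⟨hfin, hm'pos⟩ :=
    alteration_arith (m' := (m' : ℝ)) hp0 hp1 hε₂0 hε₂1 hL0 (by positivity) hm'ge hM3
  have hm'1 : 1 ≤ m' := by exact_mod_cast hm'pos
  refine ⟨m', hm'1, hm'le, subTuple ω, isCoverExpander_subTuple hexp, subTuple_pairwise ω,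
    fun x => ?_⟩
  -- the value of the sub-tuple: `(p + ε/2) M ≤ (p + ε) m'`
  have hx := (Nat.cast_le (α := ℝ)).2 (card_sat_subTuple_le P ω x)
  refine (hx.trans (hval x)).trans ?_
  show (p + ε₂) * (M : ℝ) ≤ ((NP : ℝ) / 2 ^ k + ε) * m'
  rw [← hp]
  have hε : ε = 2 * ε₂ := by rw [hε₂]; ring
  calc (p + ε₂) * (M : ℝ) ≤ (p + 2 * ε₂) * m' := hfin
    _ = (p + ε) * m' := by rw [hε]

/-! ### Theorem 4.3 (Sherali–Adams SDP): the gap for every promising predicate -/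

/-- **Benabbas–Georgiou–Magen–Tulsiani 2012, Theorem 4.3 in full (the Sherali–Adams SDP hierarchy),
value form — PROVED (`q = 2`):** for `k ≥ 3`, a promising predicate `P` and `ε > 0` there are
`c_ε > 0` and `n₀` such that for all `n ≥ n₀` some instance `ℑ` of Max-`k`-CSP(`P`) on `n` variables
has `opt(ℑ) ≤ |P⁻¹(1)|/2^k + ε` while a level-`⌊c_ε n⌋` Sherali–Adams SDP solution (consistent local
distributions together with vectors `v_0, v_(i,a)` satisfying (3.32)) gives it value exactly `1`
("By Lemma 2.3 this gives a feasible solution to the SDP obtained by `ηn/(6k)` levels. … Hence, the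
value of FRAC(`Φ`) is … `m`").
[cite: BenabbasGeorgiouMagenTulsiani2012, Thm 4.3 and its proof (p. 13), Thm 1.1] [cite: Georgiou2010, Thm 8.5.3 (p. 176–177)] -/
theorem BenabbasGeorgiouMagenTulsiani2012_saPlusValue_eq_one (hk : 3 ≤ k)
    {P : (Fin k → Bool) → Bool} (hP : PairwiseIndependence.IsPromising P) :
    ∀ ε : ℝ, 0 < ε → ∃ cε : ℝ, 0 < cε ∧ ∃ n₀ : ℕ, ∀ n : ℕ, n₀ ≤ n →
      ∃ I : CSPInstance k n (literalClosure P),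
        I.OptLE (((univ : Finset (Fin k → Bool)).filter fun y => P y = true).card / 2 ^ k + ε) ∧
        ∃ Λ : SAPlusSolution n ⌊cε * n⌋₊, Λ.saE I.val = 1 := by
  intro ε hε
  classical
  set ε' : ℝ := min ε 1 with hε'
  have hε'0 : 0 < ε' := lt_min hε one_pos
  have hε'1 : ε' ≤ 1 := min_le_right _ _
  have hε'ε : ε' ≤ ε := min_le_left _ _
  obtain ⟨Δ, hΔ, κ, hκ, n₀, H⟩ := exists_strong_predTupleK3 hk P hε'0 hε'1
  obtain ⟨μ, hμ, hsupp⟩ := hP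
  have hk0 : (0 : ℝ) ≤ k := Nat.cast_nonneg k
  refine ⟨κ / (32 * k), by positivity, max n₀ ⌈(32 * k * (k + 1) + 2) / κ⌉₊, fun n hn => ?_⟩
  have hn₀ : n₀ ≤ n := le_of_max_le_left hn
  have hκn : 32 * k * (k + 1) + 2 ≤ κ * n := by
    have h1 : (⌈(32 * k * (k + 1) + 2) / κ⌉₊ : ℝ) ≤ n := by exact_mod_cast le_of_max_le_right hn
    have h2 : (32 * k * (k + 1) + 2) / κ ≤ n := (Nat.le_ceil _).trans h1
    rw [div_le_iff₀ hκ] at h2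
    linarith
  obtain ⟨m, hm1, -, ω, hexp, hsh, hval⟩ := H n hn₀
  have hk3 : (3 : ℝ) ≤ k := by exact_mod_cast hk
  have hm : 0 < m := hm1
  -- the degree `d = ⌊κ n/(32k)⌋` and the radius `r = ⌊κ n⌋`
  set d : ℕ := ⌊κ / (32 * k) * n⌋₊ with hddef
  set r : ℕ := ⌊κ * n⌋₊ with hrdef
  have hk0' : (0 : ℝ) < k := by linarith
  have hnpos : (0 : ℝ) ≤ n := Nat.cast_nonneg _
  have hdle : (d : ℝ) ≤ κ / (32 * k) * n := Nat.floor_le (by positivity)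
  have hrge : κ * n - 1 ≤ (r : ℝ) := by
    have := Nat.lt_floor_add_one (κ * n); rw [hrdef]; linarith
  have hkd : k ≤ d := by
    refine Nat.le_floor ?_
    rw [div_mul_eq_mul_div, le_div_iff₀ (by positivity)]
    nlinarith
  have hdr : 16 * k * d ≤ r := by
    have h1 : (16 : ℝ) * k * d ≤ r := by
      have : (16 : ℝ) * k * d ≤ 16 * k * (κ / (32 * k) * n) :=
        mul_le_mul_of_nonneg_left hdle (by positivity)
      have h2 : 16 * k * (κ / (32 * k) * n) = κ * n / 2 := by field_simp; ring
      rw [h2] at this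
      nlinarith
    exact_mod_cast h1
  -- boundary expansion `k − 9/4` of the scope family, in `Fin n`
  have hbexp : Literature.Computability.MetaComplexity.IsBoundaryExpander
      (fun i => clauseScope (ω i).1) (r : ℝ) ((k : ℝ) - 9 / 4) := by
    have hexp' : IsCoverExpander (fun i => clauseScope (ω i).1) (r : ℝ)
        (((k : ℕ) + ((k : ℝ) - 9 / 4)) / 2) := by
      convert hexp using 1; ring
    exact Literature.Computability.MetaComplexity.IsCoverExpander.isBoundaryExpander
      (fun i => (card_clauseScope_of_mem_kClauses (ω i).2).le) hexp'
  have hG := expandsOff_of_isBoundaryExpander ω hbexp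
  -- hypothesis (3) in `Fin n`
  have hsh' : ∀ a b : Fin m, a ≠ b →
      (((univ : Finset (Fin k)).map (idxK (ω a))) ∩ ((univ : Finset (Fin k)).map (idxK (ω b)))).card ≤ 1 := by
    intro a b hab
    have h := hsh a b hab
    rw [clauseScope_eq_map (ω a), clauseScope_eq_map (ω b), ← Finset.map_inter, card_map] at h
    exact h
  -- the Sherali–Adams SDP solution of value `1`
  obtain ⟨Λ, hΛ⟩ := PairwiseIndependence.exists_saPlusSolution_lits hk hμ
    (fun i => idxK (ω i)) (fun i => xorPatternK (ω i)) hsh' hG hkd hdr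
  set I := predInstanceK P ω hm with hI
  have hind : ∀ i : Fin m,
      Λ.saE (fun x => if (predConstraintK P (ω i)).sat x then (1 : ℝ) else 0) = 1 := by
    intro i
    refine hΛ i _ (fun x y hxy => ?_) (fun x hx => ?_)
    · have : (predConstraintK P (ω i)).sat x = (predConstraintK P (ω i)).sat y := by
        rw [predConstraintK_sat, predConstraintK_sat]
        congr 1
        funext j
        rw [hxy (varK (ω i) j) (Finset.mem_map.2 ⟨j, mem_univ _, rfl⟩)]
      rw [this]
    · have hsat : (predConstraintK P (ω i)).sat x = true := by
        rw [predConstraintK_sat]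
        exact hsupp _ hx
      rw [hsat]
      rfl
  have hvalE : Λ.saE I.val = 1 := by
    have hfun : I.val = (1 / (m : ℝ)) •
        ∑ i : Fin m, (fun x => if (predConstraintK P (ω i)).sat x then (1 : ℝ) else 0) := by
      funext x
      rw [hI]
      unfold CSPInstance.val predInstanceK
      simp only [Pi.smul_apply, Finset.sum_apply, smul_eq_mul]
      rw [div_eq_inv_mul, one_div]
    rw [hfun, map_smul, map_sum]
    simp only [hind, sum_const, card_univ, Fintype.card_fin, nsmul_eq_mul, mul_one, smul_eq_mul]
    have : (m : ℝ) ≠ 0 := by exact_mod_cast hm.ne'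
    field_simp
  -- soundness of the instance
  have hopt : I.OptLE
      (((univ : Finset (Fin k → Bool)).filter fun y => P y = true).card / 2 ^ k + ε) := by
    intro x
    rw [hI, predInstanceK_val P ω hm x, div_le_iff₀ (by exact_mod_cast hm)]
    calc _ ≤ (_ + ε') * (m : ℝ) := hval x
      _ ≤ (((univ : Finset (Fin k → Bool)).filter fun y => P y = true).card / 2 ^ k + ε) * (m : ℝ) := by
          gcongr
  exact ⟨I, hopt, Λ, hvalE⟩

/-- **Theorem 4.3 (Sherali–Adams SDP), integrality-gap form:** for `k ≥ 3`, `P` promising and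
`ε > 0`, for all large `n` some Max-`k`-CSP(`P`) instance on `n` variables has integral optimum
`≤ |P⁻¹(1)|/2^k + ε` (as a fraction of the constraints) but Sherali–Adams SDP value `1` at level
`⌊c_ε n⌋` — integrality gap `≥ 2^k/|P⁻¹(1)| − ζ` ("the integrality gap … for the program obtained by
`cn` levels of the Sherali–Adams SDP hierarchy is at least `q^k/|P⁻¹(1)| − ζ`").
[cite: BenabbasGeorgiouMagenTulsiani2012, Thm 4.3 (p. 13) and Thm 1.1] -/
theorem BenabbasGeorgiouMagenTulsiani2012_saPlusGap (hk : 3 ≤ k)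
    {P : (Fin k → Bool) → Bool} (hP : PairwiseIndependence.IsPromising P) :
    ∀ ε : ℝ, 0 < ε → ∃ cε : ℝ, 0 < cε ∧ ∃ n₀ : ℕ, ∀ n : ℕ, n₀ ≤ n →
      ∃ (I : CSPInstance k n (literalClosure P)) (Λ : SAPlusSolution n ⌊cε * n⌋₊),
        Λ.saE I.val = 1 ∧
        ∀ x : Fin n → Bool,
          I.val x ≤ ((univ : Finset (Fin k → Bool)).filter fun y => P y = true).card / 2 ^ k + ε := by
  intro ε hε
  obtain ⟨cε, hcε, n₀, h⟩ := BenabbasGeorgiouMagenTulsiani2012_saPlusValue_eq_one hk hP ε hε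
  refine ⟨cε, hcε, n₀, fun n hn => ?_⟩
  obtain ⟨I, hopt, Λ, hΛ⟩ := h n hn
  exact ⟨I, Λ, hΛ, fun x => hopt x⟩

end Literature.Combinatorics.Optimization

end
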